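/-
Width seat `ym-line-sgb-p1-w2` (gen 2, seat prover-ym-line-sgb-p1-w2-g2-0), route `SteinGapBootstrap`, support item
`SteinTransferPairG` (stmt-QuantumFields-23639): the route decl, BY NAME.
-/
import Summits.QuantumFields.YangMills.Theorems.SteinGapBootstrapSteinTransferPairGOfSteinEquation
import Literature.MathematicalPhysics.QuantumFieldTheory.LatticeMaxwellBlockSteinEquation
import HarnessLib

/-!
# Route `SteinGapBootstrap`, support item `SteinTransferPairG` (stmt-QuantumFields-23639) — PROVED

NOT THE CLAY GAP: the route bears on the RECORD-label rung leaf `WeakCouplingRates.XiPow` (an UPPER bound on the lattice mass gap of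
torus-limit states); this item is pure Gaussian analysis (Stein's lemma for the lattice-Maxwell pair-block law).

`SteinTransferPairG`: for every `G, r, β`, torus-limit state `μ`, `n ≥ 1`, `ε ≥ 0`, with the pair block
`B = {plaquette₁₂(0), plaquette₁₂(n e₀)}`, `D = lieDim r`, `Y_B = plaqField r β |_B`: if `|E_μ[(L_B F)(Y_B)]| ≤ ε(1 + M)` for all `C²`
test functions `F` with `‖∇F‖ ≤ 1` and `M`-Lipschitz gradient (`L_B` the Ornstein–Uhlenbeck generator of the block law `γ_B`), then
`|E_μ h(Y_B) − γ_B(h)| ≤ 2ε` for every smooth `h` with `‖∇h‖ ≤ 1`, `‖∇²h‖ ≤ 1`.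

Assembly of two landed halves: the lead's bookkeeping `steinTransferPairG_of_steinEquation` (p589218: the item from the named fact
`Meckes2009_lemma1_steinEquation_latticeMaxwellBlock`, testing the hypothesis with the Stein solution `F = U_o h`, `M = ½`, `3ε/2 ≤ 2ε`)
and this seat's DISCHARGE of that named fact, `Meckes2009_lemma1_steinEquation_latticeMaxwellBlock_holds` (p589563: Stein's equation
`−L_B U_o g = g − γ_B(g)`, from Gaussian integration by parts for the block law p589267, the `t`-derivative of the Mehler interpolation
p588515 and the second-order regularity of `U_o g` p588514).  The item is therefore closed UNCONDITIONALLY.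

References: E. Meckes, IMS Collections 5 (2009) 153–178, arXiv:0902.0333, Lemmas 1–2 [Meckes2009]; S. Chatterjee, E. Meckes, ALEA 4
(2008), arXiv:math/0701464 [ChatterjeeMeckes2007]; A. D. Barbour, PTRF 84 (1990) 297 [Barbour1990].
-/

set_option autoImplicit false

namespace Summit.QuantumFields.YangMills.Theorems.SteinGapBootstrap

/-- **The support item `SteinTransferPairG` of route `SteinGapBootstrap` (stmt-QuantumFields-23639), by name, unconditionally**:
Stein's lemma for the lattice-Maxwell pair-block law — generator discrepancy `ε(1+M)` on `C²` test functions ⇒ smooth-metric closeness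
`2ε` of the pair law to the block Gaussian `γ_B` — by `steinTransferPairG_of_steinEquation` applied to the discharged Stein equation
`Meckes2009_lemma1_steinEquation_latticeMaxwellBlock_holds`.  NOT THE CLAY GAP. -/
theorem SteinTransferPairG_proof : Summit.QuantumFields.YangMills.Theses.SteinGapBootstrap.SteinTransferPairG :=
  steinTransferPairG_of_steinEquation
    Literature.MathematicalPhysics.QuantumFieldTheory.Meckes2009_lemma1_steinEquation_latticeMaxwellBlock_holds

end Summit.QuantumFields.YangMills.Theorems.SteinGapBootstrap
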